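import Literature.NumberTheory.Automorphic.QuadraticLocalNormWitnessFamily
import Literature.NumberTheory.Automorphic.UnitaryGroupNonsplitPlace
import Literature.NumberTheory.QuadraticForms.QuadraticNormIndex
import Literature.NumberTheory.QuadraticForms.HilbertSymbolArchimedean
import HarnessLib

/-!
# The `κ_v`-test of the explicit transfer factor as a norm-residue symbol: in `E ⊗_F F_v = ∏_{w ∣ v} E_w`,
# «`ι_v x = z · (σ ⊗ 1) z` for a unit `z`» ⟺ `(x, d)_v = 1`; `= +1` at every split place; `(x, d)_w = sgn σ_w(x)` at the real places

Topic `NumberTheory/Automorphic`; namespace `Literature.NumberTheory.Automorphic.UnitaryGroup` (home of ★ `LocalRing E v = ∏_{w ∣ v} E_w`, ★ `conjLocal`,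
★ `toLocalRing`, ★ `quadraticLocalEquiv`).  THEOREMS ONLY (no definition, no named fact, no instance, no notation, no `sorry`; net debt 0).  Cell
`pub/hodgecm-mathlib`, F0∕P3a, topic T6 (#72 pay-down), desk TABLE #3: the LOCAL BRIDGE shared by node N4 (product formula) and node N5 ((4.3.3)) of
`F0/P3a/T6b-TREE.md` §9 — the finite factors `κ_v(γ_H, γ′)` of Rogawski's explicit collection (★ `Rogawski1990.finKappaAt`, N1f p827456) are DEFINED by
the three-way test «`+1` if `v` splits in `L`; else `+1` iff the relative position `x_v` is `z · (c ⊗ 1) z` for a unit `z` of `∏_{w∣v} L_w`; else `−1`»,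
and print reads them as values of the endoscopic character on `inv(ι(γ_H), γ′)`, «equal to `±1` and … `+1` for almost all `v`» [Rogawski1990 §14.6
p. 242; §3.5 Prop. 3.5.2 (c)], i.e. as local NORM-RESIDUE SYMBOLS of `L_w ∕ L⁺_v`, whose product over all places of a GLOBAL `x ∈ L⁺^×` is `1`
(Hilbert reciprocity, ★ `hilbertReciprocity_holds`; product form ★ `Rogawski1990.finprod_hilbertSymbol_mul_prod_infinitePlace_hilbertSymbol_eq_one`).

SETTING.  `E ∕ F` a quadratic extension of number fields presented by `σ ∈ Aut(E∕F)`, `δ ∈ E` with `σ δ = −δ ≠ 0`, `δ² = d ∈ F` (the conventions of ★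
`QuadraticLocalNormWitnessFamily`; for `L` CM: `F = L⁺`, `σ` = complex conjugation, `d` totally negative); `v` a finite place of `F`; `ι_v = toLocalRing E v :
F_v →+* ∏_{w∣v} E_w`; ★ `hilbertSymbol (v.adicCompletion F) x d = (x, d)_v`.

* §1 **`exists_isUnit_toLocalRing_eq_mul_conjLocal_iff`** — for `x ∈ F_vˣ`: `(∃ z unit, ι_v x = z·(σ⊗1)z) ↔ (x, d)_v = 1`.  (⇐) `(x, d)_v = 1` iff `x = a² − d b²`
  (★ `hilbertSymbol_eq_one_iff_mem_quadraticNormSubgroup`, O'Meara §63B∕§65A), and `z = ι_v a + ι_v b·δ` has `z·(σ⊗1)z = ι_v(a² − d b²)` (★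
  `quadraticLocalMap_mul_conjLocal`); (⇒) every `z` is `ι_v a + ι_v b·δ` (★ `quadraticLocalMap_surjective`: `E ⊗_F F_v = F_v ⊕ F_v δ`) and `ι_v` is injective.
* §2 **`exists_isUnit_toLocalRing_eq_mul_conjLocal_of_not_subsingleton`** — at a SPLIT `v` (`¬ Subsingleton (PlacesOver E v)`: two places `w₀ ≠ σ⁻¹w₀`, ★
  `PlacesOver.eq_or_eq_galInv`) the test passes for every `x ≠ 0`: `z = (ι_{w₀} x at w₀, 1 at σ⁻¹w₀)` (★ `galAdicCompletionMap_toPlace`); hence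
  **`hilbertSymbol_eq_one_of_not_subsingleton`**: `(x, d)_v = 1` at split `v` — so ★ `finKappaAt`'s «`κ_v := +1` at split `v`» agrees with the symbol.
* §3 **`ite_normTest_eq_hilbertSymbol`** — the three-way test `(if split then 1 else if ∃ z … then 1 else −1) = (x, d)_v` at EVERY finite `v`, and the
  GLOBAL-element forms `exists_isUnit_algebraMap_eq_mul_conjLocal_iff`, `ite_normTest_algebraMap_eq_hilbertSymbol` for `x ∈ Fˣ` (`x ⊗ 1 = ι_v x`, ★
  `toLocalRing_coe`).
* §4 **`hilbertSymbol_completion_eq_sign_of_isReal`** — at a real place `w` with `σ_w(d) < 0`: `(x, d)_w = sgn σ_w(x)` (★ `hilbertSymbol_completion_eq_one_iff_of_isReal`),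
  the archimedean counterpart (★ `archKappaAt` is a `SignType.sign`).

NOT here: the identification of ★ `finRelPos` at a RATIONAL pair with `x ⊗ 1` for the global relative position `x = pᴴ H′ p` (node (R)), and the assembly
of `∏_v κ_v` (N4 ∕ N5).  HONEST LABEL: HC_CM is proved only modulo the printed citations (named inputs remaining 2) until rung 0 closes; this file is local
algebra of quadratic extensions and proves none of them.

## References
* [Omeara1963] O. T. O'Meara, *Introduction to Quadratic Forms* (1963), §63B (Hilbert symbol; over `ℝ`), §65A («local norm at `𝔭` iff `(α, θ∕𝔭) = 1`»),
  §71 Thm. 71:18.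
* [CasselsFrohlichANT1967] J. W. S. Cassels, A. Fröhlich (eds.), *Algebraic Number Theory* (1967), Ch. II §§10–11 (`L ⊗_K K_v ≅ ∏_{w∣v} L_w`), Ch. VII
  Prop. 1.2 (ii) (the Galois group permutes the places above `v` transitively).
* [Rogawski1990] J. D. Rogawski, *Automorphic Representations of Unitary Groups in Three Variables* (1990), §3.5 Prop. 3.5.2 (c), §4.3 p. 43, §14.6 p. 242.
-/

set_option autoImplicit false

noncomputable section

open NumberField IsDedekindDomain
open Literature.NumberTheory.QuadraticForms

namespace Literature.NumberTheory.Automorphic.UnitaryGroup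

variable {F : Type} (E : Type) [Field F] [NumberField F] [Field E] [NumberField E] [Algebra F E]
variable (σ : E ≃ₐ[F] E) {δ : E} (hσδ : σ δ = -δ) (hδ : δ ≠ 0) {d : F} (hd : δ * δ = algebraMap F E d)

/-! ## §1 The unit-norm test is the Hilbert symbol `(x, d)_v` -/

include hδ hd in
omit [NumberField F] [NumberField E] in
/-- `d ≠ 0` when `δ² = d`, `δ ≠ 0`. [folklore] -/
private theorem d_ne_zero : d ≠ 0 := fun h => by
  apply hδ
  have h2 : δ * δ = 0 := by rw [hd, h, map_zero]
  exact mul_self_eq_zero.1 h2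

include hσδ hδ hd in
/-- **THE UNIT-NORM TEST IS THE HILBERT SYMBOL.**  For a quadratic extension `E = F(δ)` of number fields (`σ δ = −δ ≠ 0`, `δ² = d ∈ F`), a finite
place `v` of `F` and `x ∈ F_vˣ`: `ι_v x = z · (σ ⊗ 1) z` for some unit `z` of `E ⊗_F F_v = ∏_{w ∣ v} E_w` **iff** `(x, d)_v = 1` — i.e. iff `x` is a norm
from `F_v(√d)` (O'Meara 63:10 ∕ §65A «`α` is a local norm at `𝔭` iff `(α, θ∕𝔭) = 1`», ★ `hilbertSymbol_eq_one_iff_mem_quadraticNormSubgroup`), the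
norm form of `E ⊗_F F_v = F_v ⊕ F_v δ` being `(a + bδ)(a − bδ) = a² − d b²` (★ `quadraticLocalEquiv`, ★ `quadraticLocalMap_mul_conjLocal`).  This is the
`κ_v`-test of Rogawski's explicit transfer factor (★ `finKappaAt`: «`x_v = z·(c⊗1)z` for a unit `z`») read as a norm-residue symbol.
[cite: Omeara1963, §63B with §65A (local norms and the Hilbert symbol)] [cite: CasselsFrohlichANT1967, Ch. II §10–§11] -/
theorem exists_isUnit_toLocalRing_eq_mul_conjLocal_iff [Algebra.IsQuadraticExtension F E] (v : HeightOneSpectrum (𝓞 F))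
    {x : v.adicCompletion F} (hx : x ≠ 0) :
    (∃ z : LocalRing E v, IsUnit z ∧ toLocalRing E v x = z * conjLocal E σ v z) ↔
      hilbertSymbol (v.adicCompletion F) x (d : v.adicCompletion F) = 1 := by
  haveI : CharZero (v.adicCompletion F) := charZero_of_injective_algebraMap (algebraMap F (v.adicCompletion F)).injective
  haveI : NeZero (2 : v.adicCompletion F) := ⟨two_ne_zero⟩
  have hd0 : (d : v.adicCompletion F) ≠ 0 := by
    rw [ne_eq, ← map_zero (algebraMap F (v.adicCompletion F))]
    exact fun h => d_ne_zero E hδ hd ((algebraMap F (v.adicCompletion F)).injective h)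
  rw [show x = ((Units.mk0 x hx : (v.adicCompletion F)ˣ) : v.adicCompletion F) from rfl,
    hilbertSymbol_eq_one_iff_mem_quadraticNormSubgroup hd0, mem_quadraticNormSubgroup_iff, Units.val_mk0]
  constructor
  · rintro ⟨z, -, hxz⟩
    obtain ⟨⟨a, b⟩, rfl⟩ := quadraticLocalMap_surjective E v (not_mem_range_algebraMap_of_apply_eq_neg E σ hσδ hδ) z
    refine ⟨a, b, ?_⟩
    have h := quadraticLocalMap_mul_conjLocal E σ hσδ hd v a b
    rw [← hxz] at h
    exact (toLocalRing_injective E v h).symm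
  · rintro ⟨a, b, hab⟩
    have h := quadraticLocalMap_mul_conjLocal E σ hσδ hd v a b
    rw [hab] at h
    refine ⟨quadraticLocalMap E v δ (a, b), ?_, h.symm⟩
    exact isUnit_of_mul_isUnit_left (h ▸ (IsUnit.mk0 x hx).map (toLocalRing E v))

/-! ## §2 At a SPLIT place every `x ∈ F_vˣ` passes the test: `(x, d)_v = 1` -/

/-- **At a split place the test always passes.**  If `v` splits in `E` (two places above `v`, i.e. `¬ Subsingleton (PlacesOver E v)`; then
`σ` swaps them, ★ `PlacesOver.eq_or_eq_galInv`), every `x ∈ F_vˣ` is `z · (σ ⊗ 1) z` for the unit `z = (ι_{w₀} x, 1)`: `(σ ⊗ 1) z = (1, ι_{w₁} x)`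
(★ `galAdicCompletionMap_toPlace`).  Print: «`κ(γ, ψ_v(i(γ)))` … is `+1` for almost all `v`»; ★ `finKappaAt` SETS `κ_v := +1` at split `v`, and this
lemma says that choice agrees with the norm-residue reading. [cite: CasselsFrohlichANT1967, Ch. VII Prop. 1.2 (ii)] [cite: Rogawski1990, §14.6 p. 242] -/
theorem exists_isUnit_toLocalRing_eq_mul_conjLocal_of_not_subsingleton [Algebra.IsQuadraticExtension F E] (hσ : σ ≠ 1)
    (v : HeightOneSpectrum (𝓞 F)) (hv : ¬ Subsingleton (PlacesOver E v)) {x : v.adicCompletion F} (hx : x ≠ 0) :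
    ∃ z : LocalRing E v, IsUnit z ∧ toLocalRing E v x = z * conjLocal E σ v z := by
  classical
  obtain ⟨w₀⟩ : Nonempty (PlacesOver E v) := inferInstance
  have hw₀ : σ • w₀.1 ≠ w₀.1 := fun h => hv (PlacesOver.subsingleton_of_smul_eq σ hσ w₀ h)
  have hne : PlacesOver.galInv σ w₀ ≠ w₀ := PlacesOver.galInv_ne σ w₀ hw₀
  set z : LocalRing E v := Pi.mulSingle w₀ (toPlace v w₀ x) with hzdef
  have hz0 : z w₀ = toPlace v w₀ x := Pi.mulSingle_eq_same _ _
  have hz1 : ∀ w, w ≠ w₀ → z w = 1 := fun w hw => Pi.mulSingle_eq_of_ne hw _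
  refine ⟨z, ?_, funext fun w => ?_⟩
  · refine isUnit_iff_exists_inv.2 ⟨Pi.mulSingle w₀ (toPlace v w₀ x)⁻¹, ?_⟩
    rw [hzdef, ← Pi.mulSingle_mul, mul_inv_cancel₀ ((map_ne_zero (toPlace v w₀)).2 hx), Pi.mulSingle_one]
  · rw [Pi.mul_apply, conjLocal_apply, toLocalRing_apply]
    rcases PlacesOver.eq_or_eq_galInv σ hσ w₀ w with rfl | rfl
    · rw [hz0, hz1 _ hne, map_one, mul_one]
    · rw [hz1 _ hne, one_mul]
      have key : ∀ (w' : PlacesOver E v) (h : σ • w'.1 = (PlacesOver.galInv σ w₀).1), w' = w₀ →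
          galAdicCompletionMap σ h (z w') = toPlace v (PlacesOver.galInv σ w₀) x := by
        rintro w' h rfl
        rw [hz0, galAdicCompletionMap_toPlace]
      exact (key _ _ (PlacesOver.galInv_galInv σ hσ w₀)).symm

include hσδ hδ hd in
/-- **`(x, d)_v = 1` at every split place `v`** (`x ∈ F_vˣ`): §2 read through §1 — at a place of `F` with two places of `E = F(√d)` above it, every
non-zero `x ∈ F_v` is a local norm. [cite: Omeara1963, §63B with §65A] [cite: CasselsFrohlichANT1967, Ch. VII Prop. 1.2 (ii)] -/
theorem hilbertSymbol_eq_one_of_not_subsingleton [Algebra.IsQuadraticExtension F E] (hσ : σ ≠ 1) (v : HeightOneSpectrum (𝓞 F))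
    (hv : ¬ Subsingleton (PlacesOver E v)) {x : v.adicCompletion F} (hx : x ≠ 0) :
    hilbertSymbol (v.adicCompletion F) x (d : v.adicCompletion F) = 1 :=
  (exists_isUnit_toLocalRing_eq_mul_conjLocal_iff E σ hσδ hδ hd v hx).1
    (exists_isUnit_toLocalRing_eq_mul_conjLocal_of_not_subsingleton E σ hσ v hv hx)

/-! ## §3 The three-way test of ★ `finKappaAt`, and global elements -/

open scoped Classical in
include hσδ hδ hd in
/-- **The three-way `κ`-test equals the Hilbert symbol.**  For `x ∈ F_vˣ`: `(+1 if v splits; else +1 if ι_v x = z·(σ⊗1)z for a unit z; else −1) = (x, d)_v`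
— the inner branches of ★ `finKappaAt` (with its relative position `x_v` in place of `ι_v x`) as ONE norm-residue symbol, split or not.
[cite: Omeara1963, §63B with §65A] [cite: Rogawski1990, §14.6 p. 242] -/
theorem ite_normTest_eq_hilbertSymbol [Algebra.IsQuadraticExtension F E] (hσ : σ ≠ 1) (v : HeightOneSpectrum (𝓞 F))
    {x : v.adicCompletion F} (hx : x ≠ 0) :
    (if ¬ Subsingleton (PlacesOver E v) then (1 : ℤ)
      else if ∃ z : LocalRing E v, IsUnit z ∧ toLocalRing E v x = z * conjLocal E σ v z then 1 else -1) =
      hilbertSymbol (v.adicCompletion F) x (d : v.adicCompletion F) := by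
  classical
  by_cases hv : Subsingleton (PlacesOver E v)
  · rw [if_neg (not_not.2 hv)]
    by_cases h : ∃ z : LocalRing E v, IsUnit z ∧ toLocalRing E v x = z * conjLocal E σ v z
    · rw [if_pos h]
      exact ((exists_isUnit_toLocalRing_eq_mul_conjLocal_iff E σ hσδ hδ hd v hx).1 h).symm
    · rw [if_neg h]
      rcases hilbertSymbol_eq_one_or_eq_neg_one x (d : v.adicCompletion F) with h1 | h1
      · exact absurd ((exists_isUnit_toLocalRing_eq_mul_conjLocal_iff E σ hσδ hδ hd v hx).2 h1) h
      · exact h1.symm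
  · rw [if_pos hv]
    exact (hilbertSymbol_eq_one_of_not_subsingleton E σ hσδ hδ hd hσ v hv hx).symm

include hσδ hδ hd in
/-- **Global elements.**  For `x ∈ Fˣ` the test on `x ⊗ 1 ∈ E ⊗_F F_v` (`= ι_v x`, ★ `toLocalRing_coe`) is `(x, d)_v`:
`(∃ z unit, (x ⊗ 1) = z·(σ⊗1)z) ↔ (x, d)_v = 1`. [cite: Omeara1963, §63B with §65A] [cite: Rogawski1990, §14.6 p. 242] -/
theorem exists_isUnit_algebraMap_eq_mul_conjLocal_iff [Algebra.IsQuadraticExtension F E] (v : HeightOneSpectrum (𝓞 F))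
    {x : F} (hx : x ≠ 0) :
    (∃ z : LocalRing E v, IsUnit z ∧ algebraMap E (LocalRing E v) (algebraMap F E x) = z * conjLocal E σ v z) ↔
      hilbertSymbol (v.adicCompletion F) (x : v.adicCompletion F) (d : v.adicCompletion F) = 1 := by
  rw [← toLocalRing_coe]
  exact exists_isUnit_toLocalRing_eq_mul_conjLocal_iff E σ hσδ hδ hd v
    (fun h => hx ((algebraMap F (v.adicCompletion F)).injective (h.trans (map_zero _).symm)))

open scoped Classical in
include hσδ hδ hd in
/-- **Global elements, three-way form.**  For `x ∈ Fˣ` the three-way `κ`-test on `x ⊗ 1` equals `(x, d)_v` at EVERY finite place `v`; with ★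
`finprod_hilbertSymbol_mul_prod_infinitePlace_hilbertSymbol_eq_one` (Hilbert reciprocity in product form) this is the finite part of
«`Π_v κ_v = 1` on a rational pair». [cite: Omeara1963, §71 Thm. 71:18] [cite: Rogawski1990, §14.6 p. 242] -/
theorem ite_normTest_algebraMap_eq_hilbertSymbol [Algebra.IsQuadraticExtension F E] (hσ : σ ≠ 1) (v : HeightOneSpectrum (𝓞 F))
    {x : F} (hx : x ≠ 0) :
    (if ¬ Subsingleton (PlacesOver E v) then (1 : ℤ)
      else if ∃ z : LocalRing E v, IsUnit z ∧ algebraMap E (LocalRing E v) (algebraMap F E x) = z * conjLocal E σ v z then 1 else -1) =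
      hilbertSymbol (v.adicCompletion F) (x : v.adicCompletion F) (d : v.adicCompletion F) := by
  rw [← toLocalRing_coe]
  exact ite_normTest_eq_hilbertSymbol E σ hσδ hδ hd hσ v
    (fun h => hx ((algebraMap F (v.adicCompletion F)).injective (h.trans (map_zero _).symm)))

/-! ## §4 At a real place where `d < 0` the symbol is the SIGN of `x` -/

omit [NumberField F] [NumberField E] [Algebra F E] in
/-- **At a real place `w` of `F` with `σ_w(d) < 0`** (every real place when `E = F(√d)` is CM ∕ `d` totally negative) **the symbol `(x, d)_w` is the sign
of `σ_w(x)`** for `x ∈ Fˣ` (★ `hilbertSymbol_completion_eq_one_iff_of_isReal`: `(a, b)_w = 1 ↔ σ_w a > 0 ∨ σ_w b > 0`) — the archimedean `κ_w`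
of the explicit factor (★ `archKappaAt`, a `SignType.sign`) read as a norm-residue symbol. [cite: Omeara1963, §63B (the Hilbert symbol over `ℝ`)] -/
theorem hilbertSymbol_completion_eq_sign_of_isReal {w : InfinitePlace F} (hw : w.IsReal) {x : F} (hx : x ≠ 0)
    (hdw : InfinitePlace.embedding_of_isReal hw d < 0) :
    hilbertSymbol w.Completion (algebraMap F _ x) (algebraMap F _ d) =
      ((SignType.sign (InfinitePlace.embedding_of_isReal hw x) : SignType) : ℤ) := by
  rcases lt_or_gt_of_ne ((map_ne_zero (InfinitePlace.embedding_of_isReal hw)).2 hx) with hlt | hgt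
  · rw [sign_neg hlt, SignType.coe_neg_one]
    exact (hilbertSymbol_completion_eq_neg_one_iff_of_isReal hw x d).2 ⟨hlt.le, hdw.le⟩
  · rw [sign_pos hgt, SignType.coe_one]
    exact (hilbertSymbol_completion_eq_one_iff_of_isReal hw x d).2 (Or.inl hgt)

end Literature.NumberTheory.Automorphic.UnitaryGroup
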